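import Literature.AlgebraicGeometry.Motives.FanoSchemeOfLines
import Mathlib.Algebra.MvPolynomial.Funext
import HarnessLib

/-!
# Field-valued points of the Fano scheme of lines: `F₁(V₊(S))(L)` = lines on `V₊(S)_L`

For a field `k`, a set `S ⊆ k[x₀, …, xₙ]` of forms of positive degree and a field `L ⊇ k`, this
file identifies the `L`-valued points of the Fano scheme of lines
`fanoSchemeOfLines n k S = F₁(V₊(S)) ⊆ ℙ^{n²+2n}_k` of `Motives/FanoSchemeOfLines` (the closed
subscheme of the Plücker space cut out by the alternation, Plücker and containment relations) with
the **lines on `V₊(S)` defined over `L`**: the `2`-dimensional subspaces `W ⊆ Lⁿ⁺¹` (lines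
`ℙ(W) ⊆ ℙⁿ_L`) on which every `g ∈ S` vanishes *identically*, `g(su + tv) = 0` in `L[s, t]` for
`u, v ∈ W` (Eisenbud–Harris, *3264 and all that*, §6.1.1: "a plane `L` lies on `X` if and only if
the restriction of `g` to `L` is zero … the condition `L ⊂ X` is given by the vanishing of the
coefficients of `α^*(g)`"; Prop. 6.6: `F_k(X)` represents families of `k`-planes on `X`, so its
`L`-points are the `k`-planes on `X_L`).

* `FanoScheme.wedge u v` — the decomposable alternating matrix `(uᵢvⱼ - uⱼvᵢ)`; it is non-zero iff
  `u, v` are linearly independent (`wedge_ne_zero_iff`), its row space is `span(u, v)`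
  (`span_range_wedge`), `[u ∧ v]` determines `span(u, v)` (`span_pair_eq_iff_exists_wedge_eq_smul`),
  and an alternating matrix satisfying the Plücker relations is decomposable on the chart
  `p_{ab} ≠ 0`: `p = p_{a•} ∧ p_{b•}/p_{ab}` (`eq_wedge_of_pluecker`; Eisenbud–Harris §3.2.1–3.2.2).
* `FanoScheme.lineRestrict u v g = g(su + tv) ∈ L[s, t]`; the containment relations of `g`
  evaluated at `u ∧ v` are the coefficients of `θ_{u,v}(g(su + tv))`, `θ_{u,v} : s ↦ ⟨v, ξ⟩,
  t ↦ -⟨u, ξ⟩` (`aeval_vecOfMatrix_containmentRel`, `aeval_contractionAt_wedge`), and `θ_{u,v}` is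
  injective for independent `u, v` (`plueckerSubst_injective`), so they vanish iff `g(su + tv) = 0`
  (`aeval_contractionAt_wedge_eq_zero_iff`).
* `FanoScheme.linePoint hS u v` — the `L`-point `[u ∧ v]` of `F₁(V₊(S))`; every `L`-point is of
  this form (`exists_eq_linePoint`), `[u ∧ v] = [u' ∧ v'] ↔ span(u, v) = span(u', v')`
  (`linePoint_eq_linePoint_iff`), and the Plücker embedding sends `[u ∧ v]` to the point with
  homogeneous coordinates `(uᵢvⱼ - uⱼvᵢ)` (`map_linePoint`).
* `FanoScheme.linesOn S L` and **`FanoScheme.algPointsEquivLinesOn hS :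
  AlgPoints (fanoSchemeOfLines n k S) L ≃ linesOn S L`**, `[u ∧ v] ↦ span(u, v)`; over an infinite
  field the lines on `V₊(S)` are the `2`-planes on whose vectors `S` vanishes
  (`mem_linesOn_iff_of_infinite`, `algPointsEquivLinesOnOfInfinite`); for `S = ∅`,
  `G(1, ℙⁿ_k)(L) ≃ {W ⊆ Lⁿ⁺¹ : dim W = 2}` (`grassmannianPointsEquiv`).

## What is NOT here

* Points with values in rings (the full functor of points / Prop. 6.6 for arbitrary bases), the
  universal line `{(ℓ, x) : x ∈ ℓ} → F₁`, tangent spaces, smoothness and dimension of `F₁`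
  (Debarre–Manivel; Kollár V.4).
* The translation of a line `ℙ(W) ⊆ ℙⁿ_L` into a height-one point of `V₊(S)` whose closure is a
  linear `ℙ¹` (dimension theory of linear subspaces of `Proj`); here a line is the subspace `W`.

## References

* D. Eisenbud, J. Harris, *3264 and All That*, Cambridge (2016): §3.2.1 (Plücker relations
  `g_{a,b,c,d}`, decomposability, p. 131), §3.2.2 (affine charts `p_{ab} ≠ 0`, row spaces),
  §6.1.1 (definition of the Fano scheme by the coefficients of `g(su + tv)`, pp. 223–224),
  Prop. 6.6 (p. 230). [EisenbudHarris2016]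
-/

noncomputable section

open CategoryTheory AlgebraicGeometry MvPolynomial

universe u

namespace Literature.AlgebraicGeometry.Motives

namespace FanoScheme

/-! ## Decomposable alternating matrices `u ∧ v` -/

section Wedge

variable {L : Type u} [Field L] {n : ℕ}

/-- **The decomposable alternating matrix `u ∧ v`**, `(u ∧ v)_{ij} = uᵢ vⱼ - uⱼ vᵢ`: the Plücker
coordinates of the line spanned by `u, v ∈ Lⁿ⁺¹` (Eisenbud–Harris §3.2.1, the `2 × 2` minors of the
matrix with rows `u, v`). [cite: EisenbudHarris2016, §3.2.1] -/
def wedge (u v : Fin (n + 1) → L) : Fin (n + 1) → Fin (n + 1) → L :=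
  fun i j => u i * v j - u j * v i

/-- `(u ∧ v)_{ij} = uᵢ vⱼ - uⱼ vᵢ` (`rfl`). [folklore] -/
theorem wedge_apply (u v : Fin (n + 1) → L) (i j : Fin (n + 1)) :
    wedge u v i j = u i * v j - u j * v i := rfl

/-- `(u ∧ v)_{ii} = 0`. [folklore] -/
theorem wedge_self (u v : Fin (n + 1) → L) (i : Fin (n + 1)) : wedge u v i i = 0 := by
  simp [wedge]

/-- `(u ∧ v)_{ji} = -(u ∧ v)_{ij}`. [folklore] -/
theorem wedge_swap (u v : Fin (n + 1) → L) (i j : Fin (n + 1)) :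
    wedge u v j i = -wedge u v i j := by
  simp only [wedge]; ring

/-- **`u ∧ v` satisfies the Plücker relations** `p_{ab}p_{cd} - p_{ac}p_{bd} + p_{ad}p_{bc} = 0`.
[cite: EisenbudHarris2016, §3.2.1] -/
theorem wedge_pluecker (u v : Fin (n + 1) → L) (a b c d : Fin (n + 1)) :
    wedge u v a b * wedge u v c d - wedge u v a c * wedge u v b d +
      wedge u v a d * wedge u v b c = 0 := by
  simp only [wedge]; ring

/-- Change of basis: `(αu + βv) ∧ (γu + δv) = (αδ - βγ) · u ∧ v`. [folklore] -/
theorem wedge_linComb (u v : Fin (n + 1) → L) (α β γ δ : L) :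
    wedge (α • u + β • v) (γ • u + δ • v) = (α * δ - β * γ) • wedge u v := by
  ext i j
  simp only [wedge, Pi.add_apply, Pi.smul_apply, smul_eq_mul]
  ring

/-- `u ∧ (c v) = c · u ∧ v`. [folklore] -/
theorem wedge_smul_right (u v : Fin (n + 1) → L) (c : L) :
    wedge u (c • v) = c • wedge u v := by
  ext i j
  simp only [wedge, Pi.smul_apply, smul_eq_mul]
  ring

/-- Ring homomorphisms act on `u ∧ v` entrywise: `(f ∘ u) ∧ (f ∘ v) = f ∘ (u ∧ v)`. [folklore] -/
theorem wedge_map {L' : Type u} [Field L'] (f : L →+* L') (u v : Fin (n + 1) → L) :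
    wedge (fun j => f (u j)) (fun j => f (v j)) = fun i j => f (wedge u v i j) := by
  ext i j
  simp [wedge]

/-- A non-zero matrix has a non-zero entry. [folklore] -/
theorem exists_apply_ne_zero_of_ne_zero {p : Fin (n + 1) → Fin (n + 1) → L} (hp : p ≠ 0) :
    ∃ a b, p a b ≠ 0 := by
  obtain ⟨a, ha⟩ := Function.ne_iff.mp hp
  obtain ⟨b, hb⟩ := Function.ne_iff.mp ha
  exact ⟨a, b, hb⟩

/-- **`u ∧ v ≠ 0` iff `u, v` are linearly independent** (some `2 × 2` minor of the matrix with
rows `u, v` is non-zero iff it has rank `2`). [folklore] -/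
theorem wedge_ne_zero_iff (u v : Fin (n + 1) → L) :
    wedge u v ≠ 0 ↔ LinearIndependent L ![u, v] := by
  rw [LinearIndependent.pair_iff]
  constructor
  · intro h s t hst
    obtain ⟨a, b, hD⟩ := exists_apply_ne_zero_of_ne_zero h
    have hj : ∀ j, s * u j + t * v j = 0 := fun j => by
      have := congr_fun hst j
      simpa using this
    have hs : s * wedge u v a b = 0 := by
      simp only [wedge]
      linear_combination (v b) * hj a - (v a) * hj b
    have ht : t * wedge u v a b = 0 := by
      simp only [wedge]
      linear_combination (u a) * hj b - (u b) * hj a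
    exact ⟨(mul_eq_zero.mp hs).resolve_right hD, (mul_eq_zero.mp ht).resolve_right hD⟩
  · intro h h0
    have hu : u ≠ 0 := by
      intro hu
      have := (h 1 0 (by simp [hu])).1
      exact one_ne_zero this
    obtain ⟨a, ha⟩ := Function.ne_iff.mp hu
    have key : (v a) • u + (-u a) • v = 0 := by
      ext j
      have hj : wedge u v a j = 0 := by rw [h0]; rfl
      simp only [wedge] at hj
      simp only [Pi.add_apply, Pi.smul_apply, smul_eq_mul, Pi.zero_apply]
      linear_combination -hj
    exact ha (neg_eq_zero.mp (h _ _ key).2)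

/-- **Decomposability on the chart `p_{ab} ≠ 0`**: a matrix satisfying the Plücker relations
`p_{ab}p_{ij} - p_{ai}p_{bj} + p_{aj}p_{bi} = 0` with `p_{ab} ≠ 0` is `p = p_{a•} ∧ (p_{b•}/p_{ab})`,
the wedge of (multiples of) its rows `a` and `b` (Eisenbud–Harris §3.2.1: the Plücker relations
say that `η` is decomposable; §3.2.2: on `U_Γ = {p_{ab} ≠ 0}` a plane is the row space of a
normalised matrix). [cite: EisenbudHarris2016, §3.2.1] -/
theorem eq_wedge_of_pluecker {p : Fin (n + 1) → Fin (n + 1) → L} {a b : Fin (n + 1)}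
    (hpl : ∀ i j, p a b * p i j - p a i * p b j + p a j * p b i = 0) (hab : p a b ≠ 0) :
    p = wedge (p a) ((p a b)⁻¹ • p b) := by
  ext i j
  simp only [wedge, Pi.smul_apply, smul_eq_mul]
  have h := hpl i j
  field_simp
  linear_combination h

/-- Every row `(u ∧ v)_{i•} = uᵢ v - vᵢ u` lies in `span(u, v)`. [folklore] -/
theorem wedge_row_mem_span (u v : Fin (n + 1) → L) (i : Fin (n + 1)) :
    wedge u v i ∈ Submodule.span L {u, v} := by
  have h : wedge u v i = (-v i) • u + (u i) • v := by
    ext j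
    simp only [wedge, Pi.add_apply, Pi.smul_apply, smul_eq_mul]
    ring
  rw [h]
  exact Submodule.add_mem _
    (Submodule.smul_mem _ _ (Submodule.subset_span (Set.mem_insert u {v})))
    (Submodule.smul_mem _ _ (Submodule.subset_span (Set.mem_insert_of_mem u rfl)))

/-- **The row space of `u ∧ v` is `span(u, v)`** for `u, v` linearly independent: the line is
recovered from its Plücker coordinates (Eisenbud–Harris §3.2.2). [cite: EisenbudHarris2016, §3.2.2] -/
theorem span_range_wedge (u v : Fin (n + 1) → L) (huv : LinearIndependent L ![u, v]) :
    Submodule.span L (Set.range (wedge u v)) = Submodule.span L {u, v} := by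
  apply le_antisymm
  · rw [Submodule.span_le]
    rintro _ ⟨i, rfl⟩
    exact wedge_row_mem_span u v i
  · obtain ⟨a, b, hD⟩ := exists_apply_ne_zero_of_ne_zero ((wedge_ne_zero_iff u v).mpr huv)
    have hra : wedge u v a ∈ Submodule.span L (Set.range (wedge u v)) :=
      Submodule.subset_span ⟨a, rfl⟩
    have hrb : wedge u v b ∈ Submodule.span L (Set.range (wedge u v)) :=
      Submodule.subset_span ⟨b, rfl⟩
    have hu : u = (wedge u v a b)⁻¹ • (u b • wedge u v a - u a • wedge u v b) := by
      ext j
      simp only [Pi.smul_apply, Pi.sub_apply, smul_eq_mul]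
      rw [eq_comm, inv_mul_eq_iff_eq_mul₀ hD]
      simp only [wedge]
      ring
    have hv : v = (wedge u v a b)⁻¹ • (v b • wedge u v a - v a • wedge u v b) := by
      ext j
      simp only [Pi.smul_apply, Pi.sub_apply, smul_eq_mul]
      rw [eq_comm, inv_mul_eq_iff_eq_mul₀ hD]
      simp only [wedge]
      ring
    rw [Submodule.span_le, Set.insert_subset_iff, Set.singleton_subset_iff]
    constructor
    · have hmem : (wedge u v a b)⁻¹ • (u b • wedge u v a - u a • wedge u v b) ∈
          Submodule.span L (Set.range (wedge u v)) :=
        Submodule.smul_mem _ _ (Submodule.sub_mem _ (Submodule.smul_mem _ _ hra)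
          (Submodule.smul_mem _ _ hrb))
      rw [← hu] at hmem
      exact hmem
    · have hmem : (wedge u v a b)⁻¹ • (v b • wedge u v a - v a • wedge u v b) ∈
          Submodule.span L (Set.range (wedge u v)) :=
        Submodule.smul_mem _ _ (Submodule.sub_mem _ (Submodule.smul_mem _ _ hra)
          (Submodule.smul_mem _ _ hrb))
      rw [← hv] at hmem
      exact hmem

/-- If all rows of `u ∧ v` (`u, v` independent) lie in a subspace `W`, then `span(u, v) ≤ W`
(the row space of `u ∧ v` is `span(u, v)`). [folklore] -/
theorem span_pair_le_of_rows_mem {u v : Fin (n + 1) → L} (huv : LinearIndependent L ![u, v])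
    {W : Submodule L (Fin (n + 1) → L)} (h : ∀ i, wedge u v i ∈ W) :
    Submodule.span L {u, v} ≤ W := by
  rw [← span_range_wedge u v huv, Submodule.span_le]
  rintro _ ⟨i, rfl⟩
  exact h i

/-- If `span(u', v') ≤ span(u, v)` with `u', v'` independent, then `u' ∧ v' = c · u ∧ v` for some
`c ≠ 0` (the determinant of the change of basis). [folklore] -/
theorem exists_wedge_eq_smul_wedge {u v u' v' : Fin (n + 1) → L}
    (huv' : LinearIndependent L ![u', v'])
    (h : Submodule.span L {u', v'} ≤ Submodule.span L {u, v}) :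
    ∃ c : L, c ≠ 0 ∧ wedge u' v' = c • wedge u v := by
  have hu' : u' ∈ Submodule.span L {u, v} := h (Submodule.subset_span (Set.mem_insert u' {v'}))
  have hv' : v' ∈ Submodule.span L {u, v} :=
    h (Submodule.subset_span (Set.mem_insert_of_mem u' rfl))
  rw [Submodule.mem_span_pair] at hu' hv'
  obtain ⟨α, β, rfl⟩ := hu'
  obtain ⟨γ, δ, rfl⟩ := hv'
  refine ⟨α * δ - β * γ, ?_, wedge_linComb u v α β γ δ⟩
  intro h0
  have h1 := wedge_linComb u v α β γ δ
  rw [h0, zero_smul] at h1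
  exact (wedge_ne_zero_iff _ _).mpr huv' h1

/-- Scaling a family of vectors by `c ≠ 0` does not change its span. [folklore] -/
theorem span_range_smul {ι : Type*} (c : L) (hc : c ≠ 0) (p : ι → Fin (n + 1) → L) :
    Submodule.span L (Set.range (c • p)) = Submodule.span L (Set.range p) := by
  apply le_antisymm
  · rw [Submodule.span_le]
    rintro _ ⟨i, rfl⟩
    exact Submodule.smul_mem _ c (Submodule.subset_span ⟨i, rfl⟩)
  · rw [Submodule.span_le]
    rintro _ ⟨i, rfl⟩
    have h : p i = c⁻¹ • (c • p) i := by
      rw [Pi.smul_apply, smul_smul, inv_mul_cancel₀ hc, one_smul]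
    rw [SetLike.mem_coe, h]
    exact Submodule.smul_mem _ _ (Submodule.subset_span ⟨i, rfl⟩)

/-- If `u' ∧ v' = c · u ∧ v` with `c ≠ 0` (both pairs independent), then `span(u', v') = span(u, v)`
(compare row spaces). [folklore] -/
theorem span_pair_eq_of_wedge_eq_smul {u v u' v' : Fin (n + 1) → L}
    (huv : LinearIndependent L ![u, v]) (huv' : LinearIndependent L ![u', v']) {c : L}
    (hc : c ≠ 0) (h : wedge u' v' = c • wedge u v) :
    Submodule.span L {u', v'} = Submodule.span L {u, v} := by
  rw [← span_range_wedge u' v' huv', ← span_range_wedge u v huv, h, span_range_smul c hc]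

/-- **`span(u', v') = span(u, v)` iff `u' ∧ v'` and `u ∧ v` are proportional** (independent pairs):
the Plücker point `[u ∧ v] ∈ ℙ(Λ² Lⁿ⁺¹)` depends exactly on the `2`-plane `span(u, v)`
(Eisenbud–Harris §3.2.1, the Plücker embedding is injective on `k`-planes).
[cite: EisenbudHarris2016, §3.2.1] -/
theorem span_pair_eq_iff_exists_wedge_eq_smul {u v u' v' : Fin (n + 1) → L}
    (huv : LinearIndependent L ![u, v]) (huv' : LinearIndependent L ![u', v']) :
    Submodule.span L {u', v'} = Submodule.span L {u, v} ↔
      ∃ c : L, c ≠ 0 ∧ wedge u' v' = c • wedge u v :=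
  ⟨fun h => exists_wedge_eq_smul_wedge huv' h.le,
    fun ⟨_, hc, h⟩ => span_pair_eq_of_wedge_eq_smul huv huv' hc h⟩

omit [Field L] in
/-- `Set.range ![u, v] = {u, v}`. [folklore] -/
theorem range_vecCons_pair (u v : Fin (n + 1) → L) : Set.range ![u, v] = {u, v} := by
  rw [Matrix.range_cons, Matrix.range_cons, Matrix.range_empty, Set.union_empty,
    Set.singleton_union]

/-- `dim span(u, v) = 2` for `u, v` linearly independent. [folklore] -/
theorem finrank_span_pair {u v : Fin (n + 1) → L} (huv : LinearIndependent L ![u, v]) :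
    Module.finrank L (Submodule.span L {u, v}) = 2 := by
  rw [← range_vecCons_pair, finrank_span_eq_card huv, Fintype.card_fin]

/-- A `2`-dimensional subspace is spanned by two linearly independent vectors. [folklore] -/
theorem exists_span_pair_eq_of_finrank_eq_two (W : Submodule L (Fin (n + 1) → L))
    (hW : Module.finrank L W = 2) :
    ∃ u v : Fin (n + 1) → L, LinearIndependent L ![u, v] ∧ Submodule.span L {u, v} = W := by
  let b := Module.finBasisOfFinrankEq L W hW
  have hfun : (⇑W.subtype ∘ ⇑b) =
      ![((b 0 : W) : Fin (n + 1) → L), ((b 1 : W) : Fin (n + 1) → L)] := by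
    funext i
    fin_cases i <;> rfl
  refine ⟨b 0, b 1, ?_, ?_⟩
  · have h := b.linearIndependent.map' W.subtype W.ker_subtype
    rwa [hfun] at h
  · have h1 : ({((b 0 : W) : Fin (n + 1) → L), ((b 1 : W) : Fin (n + 1) → L)} :
        Set (Fin (n + 1) → L)) = W.subtype '' Set.range b := by
      rw [← range_vecCons_pair, ← Set.range_comp, hfun]
    rw [h1, Submodule.span_image, b.span_eq, Submodule.map_top, Submodule.range_subtype]

end Wedge

/-! ## Restriction of polynomials to lines: `g(su + tv)` and `g(p ⌟ ξ)` -/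

section Restrict

variable {k : Type u} [Field k] {L : Type u} [Field L] [Algebra k L] {n : ℕ}

/-- **The restriction `g(su + tv) ∈ L[s, t]` of `g ∈ k[x₀, …, xₙ]` to the line through
`u, v ∈ Lⁿ⁺¹`** (`s = X 0`, `t = X 1`): Eisenbud–Harris' `α^*(g)` for the parametrisation
`α : (s, t) ↦ su + tv` of the line (§6.1.1, p. 224). [cite: EisenbudHarris2016, §6.1.1] -/
def lineRestrict (u v : Fin (n + 1) → L) (g : MvPolynomial (Fin (n + 1)) k) :
    MvPolynomial (Fin 2) L :=
  aeval (fun i => C (u i) * X 0 + C (v i) * X 1) g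

/-- **The contraction `(p ⌟ ξ)_i = Σ_j p_{ij} ξ_j ∈ L[ξ]`** of an `L`-valued matrix `p`: the
specialisation of `FanoScheme.contraction` at the Plücker coordinates `p`. [folklore] -/
def contractionAt (p : Fin (n + 1) → Fin (n + 1) → L) (i : Fin (n + 1)) :
    MvPolynomial (Fin (n + 1)) L :=
  ∑ j : Fin (n + 1), C (p i j) * X j

/-- **The substitution `θ_{u,v} : L[s, t] → L[ξ₀, …, ξₙ]`, `s ↦ ⟨v, ξ⟩`, `t ↦ -⟨u, ξ⟩`**, for which
`(u ∧ v) ⌟ ξ = ⟨v, ξ⟩ u - ⟨u, ξ⟩ v = θ_{u,v}(su + tv)`. [folklore] -/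
def plueckerSubst (u v : Fin (n + 1) → L) :
    MvPolynomial (Fin 2) L →ₐ[L] MvPolynomial (Fin (n + 1)) L :=
  aeval ![∑ j : Fin (n + 1), C (v j) * X j, -∑ j : Fin (n + 1), C (u j) * X j]

/-- `((u ∧ v) ⌟ ξ)_i = uᵢ ⟨v, ξ⟩ - vᵢ ⟨u, ξ⟩`. [folklore] -/
theorem contractionAt_wedge (u v : Fin (n + 1) → L) (i : Fin (n + 1)) :
    contractionAt (wedge u v) i =
      C (u i) * (∑ j : Fin (n + 1), C (v j) * X j) +
        C (v i) * (-∑ j : Fin (n + 1), C (u j) * X j) := by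
  simp only [contractionAt, wedge, Finset.mul_sum, mul_neg, ← sub_eq_add_neg,
    ← Finset.sum_sub_distrib, map_sub, map_mul]
  refine Finset.sum_congr rfl fun j _ => ?_
  ring

/-- **`g((u ∧ v) ⌟ ξ) = θ_{u,v}(g(su + tv))`.** [folklore] -/
theorem aeval_contractionAt_wedge (u v : Fin (n + 1) → L) (g : MvPolynomial (Fin (n + 1)) k) :
    aeval (contractionAt (wedge u v)) g = plueckerSubst u v (lineRestrict u v g) := by
  have key : (aeval (contractionAt (wedge u v)) :
      MvPolynomial (Fin (n + 1)) k →ₐ[k] MvPolynomial (Fin (n + 1)) L) =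
      ((plueckerSubst u v).restrictScalars k).comp
        (aeval fun i => C (u i) * X 0 + C (v i) * X 1) := by
    apply MvPolynomial.algHom_ext
    intro i
    rw [aeval_X, contractionAt_wedge]
    simp [plueckerSubst]
  exact DFunLike.congr_fun key g

/-- **`θ_{u,v}` is injective for `u, v` linearly independent**: on a `2 × 2` minor
`D = uₐv_b - u_bvₐ ≠ 0` the substitution `ξₐ ↦ -(u_b s + v_b t)/D`, `ξ_b ↦ (uₐ s + vₐ t)/D`,
`ξ_j ↦ 0` otherwise, is a left inverse (the linear forms `⟨v, ξ⟩, -⟨u, ξ⟩` are part of a coordinate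
system). [folklore] -/
theorem plueckerSubst_injective (u v : Fin (n + 1) → L) (huv : LinearIndependent L ![u, v]) :
    Function.Injective (plueckerSubst u v) := by
  classical
  obtain ⟨a, b, hD⟩ := exists_apply_ne_zero_of_ne_zero ((wedge_ne_zero_iff u v).mpr huv)
  have hab : a ≠ b := by
    rintro rfl
    exact hD (wedge_self u v a)
  set D := wedge u v a b with hD_def
  let A : MvPolynomial (Fin 2) L := -(C D⁻¹ * (C (u b) * X 0 + C (v b) * X 1))
  let B : MvPolynomial (Fin 2) L := C D⁻¹ * (C (u a) * X 0 + C (v a) * X 1)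
  let f : Fin (n + 1) → MvPolynomial (Fin 2) L := fun j =>
    if j = a then A else if j = b then B else 0
  have hfa : f a = A := if_pos rfl
  have hfb : f b = B := by
    simp [f, hab.symm]
  have hf0 : ∀ j, j ≠ a ∧ j ≠ b → f j = 0 := fun j hj => by
    simp only [f, if_neg hj.1, if_neg hj.2]
  have hrel : C D⁻¹ * (C (u a) * C (v b) - C (u b) * C (v a)) = (1 : MvPolynomial (Fin 2) L) := by
    rw [← map_mul, ← map_mul, ← map_sub, ← map_mul, ← wedge_apply, ← hD_def, inv_mul_cancel₀ hD,
      map_one]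
  have hsum : ∀ w : Fin (n + 1) → L,
      (aeval f) (∑ j : Fin (n + 1), C (w j) * X j) = C (w a) * A + C (w b) * B := by
    intro w
    simp only [map_sum, map_mul, aeval_C, aeval_X, MvPolynomial.algebraMap_eq]
    rw [Fintype.sum_eq_add a b hab (fun j hj => by rw [hf0 j hj, mul_zero]), hfa, hfb]
  have key : (aeval f).comp (plueckerSubst u v) = AlgHom.id L _ := by
    apply MvPolynomial.algHom_ext
    intro i
    fin_cases i
    · simp only [plueckerSubst, AlgHom.comp_apply, AlgHom.id_apply, Fin.zero_eta, aeval_X,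
        Matrix.cons_val_zero]
      rw [hsum]
      simp only [A, B]
      linear_combination (X 0 : MvPolynomial (Fin 2) L) * hrel
    · simp only [plueckerSubst, AlgHom.comp_apply, AlgHom.id_apply, Fin.mk_one, aeval_X,
        Matrix.cons_val_one, Matrix.cons_val_zero, map_neg]
      rw [hsum]
      simp only [A, B]
      linear_combination (X 1 : MvPolynomial (Fin 2) L) * hrel
  intro x y hxy
  have h := congrArg (aeval f) hxy
  rwa [← AlgHom.comp_apply, ← AlgHom.comp_apply, key, AlgHom.id_apply, AlgHom.id_apply] at h

/-- **`g((u ∧ v) ⌟ ξ) = 0 ↔ g(su + tv) = 0`** for `u, v` linearly independent: the containment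
relations at `u ∧ v` express exactly that `g` vanishes identically on the line (Eisenbud–Harris
§6.1.1). [cite: EisenbudHarris2016, §6.1.1] -/
theorem aeval_contractionAt_wedge_eq_zero_iff {u v : Fin (n + 1) → L}
    (huv : LinearIndependent L ![u, v]) (g : MvPolynomial (Fin (n + 1)) k) :
    aeval (contractionAt (wedge u v)) g = 0 ↔ lineRestrict u v g = 0 := by
  rw [aeval_contractionAt_wedge]
  exact (plueckerSubst_injective u v huv).eq_iff' (map_zero _)

/-- **Change of parametrisation**: `g(s(αu + βv) + t(γu + δv))` is obtained from `g(su + tv)` by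
the linear substitution `s ↦ αs + γt`, `t ↦ βs + δt`. [folklore] -/
theorem lineRestrict_linComb (u v : Fin (n + 1) → L) (α β γ δ : L)
    (g : MvPolynomial (Fin (n + 1)) k) :
    lineRestrict (α • u + β • v) (γ • u + δ • v) g =
      aeval ![C α * X 0 + C γ * X 1, C β * X 0 + C δ * X 1] (lineRestrict u v g) := by
  have key : (aeval (fun i => C ((α • u + β • v) i) * X 0 + C ((γ • u + δ • v) i) * X 1) :
      MvPolynomial (Fin (n + 1)) k →ₐ[k] MvPolynomial (Fin 2) L) =
      ((aeval ![C α * X 0 + C γ * X 1, C β * X 0 + C δ * X 1] :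
          MvPolynomial (Fin 2) L →ₐ[L] MvPolynomial (Fin 2) L).restrictScalars k).comp
        (aeval fun i => C (u i) * X 0 + C (v i) * X 1) := by
    apply MvPolynomial.algHom_ext
    intro i
    simp only [aeval_X, AlgHom.comp_apply, AlgHom.restrictScalars_apply, map_add, map_mul,
      aeval_C, MvPolynomial.algebraMap_eq, Matrix.cons_val_zero, Matrix.cons_val_one,
      Matrix.cons_val_fin_one, Pi.add_apply, Pi.smul_apply, smul_eq_mul]
    ring
  exact DFunLike.congr_fun key g

/-- If `g(su + tv) = 0` then `g(su' + tv') = 0` for all `u', v' ∈ span(u, v)`: vanishing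
identically on a line does not depend on the parametrisation. [folklore] -/
theorem lineRestrict_eq_zero_of_mem_span {u v u' v' : Fin (n + 1) → L}
    {g : MvPolynomial (Fin (n + 1)) k} (hg : lineRestrict u v g = 0)
    (hu' : u' ∈ Submodule.span L {u, v}) (hv' : v' ∈ Submodule.span L {u, v}) :
    lineRestrict u' v' g = 0 := by
  rw [Submodule.mem_span_pair] at hu' hv'
  obtain ⟨α, β, rfl⟩ := hu'
  obtain ⟨γ, δ, rfl⟩ := hv'
  rw [lineRestrict_linComb, hg, map_zero]

/-- `g(su + tv)` evaluated at `(s, t) = (x₀, x₁)` is `g(x₀u + x₁v)`. [folklore] -/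
theorem eval_lineRestrict (u v : Fin (n + 1) → L) (g : MvPolynomial (Fin (n + 1)) k)
    (x : Fin 2 → L) : eval x (lineRestrict u v g) = aeval (x 0 • u + x 1 • v) g := by
  have key : (aeval (x 0 • u + x 1 • v) : MvPolynomial (Fin (n + 1)) k →ₐ[k] L) =
      ((aeval x : MvPolynomial (Fin 2) L →ₐ[L] L).restrictScalars k).comp
        (aeval fun i => C (u i) * X 0 + C (v i) * X 1) := by
    apply MvPolynomial.algHom_ext
    intro i
    simp only [aeval_X, AlgHom.comp_apply, AlgHom.restrictScalars_apply, map_add, map_mul,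
      aeval_C, Algebra.algebraMap_self_apply, Pi.add_apply, Pi.smul_apply, smul_eq_mul]
    ring
  have h := DFunLike.congr_fun key g
  rw [h]
  rfl

/-- If `g(su + tv) = 0` in `L[s, t]` then `g(su + tv) = 0` for all `s, t ∈ L`. [folklore] -/
theorem aeval_eq_zero_of_lineRestrict_eq_zero {u v : Fin (n + 1) → L}
    {g : MvPolynomial (Fin (n + 1)) k} (hg : lineRestrict u v g = 0) (s t : L) :
    aeval (s • u + t • v) g = 0 := by
  have h1 := eval_lineRestrict u v g ![s, t]
  rw [hg, map_zero] at h1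
  simpa using h1.symm

/-- **Over an infinite field, `g(su + tv) = 0` in `L[s, t]` iff `g(su + tv) = 0` for all
`s, t ∈ L`** (Mathlib `MvPolynomial.funext`). Over a finite field only `→` holds. [folklore] -/
theorem lineRestrict_eq_zero_iff_of_infinite [Infinite L] (u v : Fin (n + 1) → L)
    (g : MvPolynomial (Fin (n + 1)) k) :
    lineRestrict u v g = 0 ↔ ∀ s t : L, aeval (s • u + t • v) g = 0 := by
  constructor
  · intro h s t
    exact aeval_eq_zero_of_lineRestrict_eq_zero h s t
  · intro h
    apply MvPolynomial.funext
    intro x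
    rw [eval_lineRestrict, h, map_zero]

/-- **`k`-automorphisms of `L` act on `g(su + tv)` coefficientwise**:
`g(s σ(u) + t σ(v)) = σ(g(su + tv))` for `σ ∈ Aut(L/k)` (`g` has coefficients in `k`). [folklore] -/
theorem lineRestrict_algEquiv (σ : L ≃ₐ[k] L) (u v : Fin (n + 1) → L)
    (g : MvPolynomial (Fin (n + 1)) k) :
    lineRestrict (fun j => σ (u j)) (fun j => σ (v j)) g =
      MvPolynomial.map (σ : L →+* L) (lineRestrict u v g) := by
  have key : (aeval (fun i => C (σ (u i)) * X 0 + C (σ (v i)) * X 1) :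
      MvPolynomial (Fin (n + 1)) k →ₐ[k] MvPolynomial (Fin 2) L) =
      (mapAlgHom (σ : L →ₐ[k] L)).comp (aeval fun i => C (u i) * X 0 + C (v i) * X 1) := by
    apply MvPolynomial.algHom_ext
    intro i
    simp [map_X, map_C]
  have h := DFunLike.congr_fun key g
  simpa [lineRestrict] using h

/-- `g(s σ(u) + t σ(v)) = 0 ↔ g(su + tv) = 0` for `σ ∈ Aut(L/k)`. [folklore] -/
theorem lineRestrict_algEquiv_eq_zero_iff (σ : L ≃ₐ[k] L) (u v : Fin (n + 1) → L)
    (g : MvPolynomial (Fin (n + 1)) k) :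
    lineRestrict (fun j => σ (u j)) (fun j => σ (v j)) g = 0 ↔ lineRestrict u v g = 0 := by
  rw [lineRestrict_algEquiv]
  exact (MvPolynomial.map_injective (σ : L →+* L) σ.injective).eq_iff' (map_zero _)

end Restrict

/-! ## Plücker coordinates with values in a field -/

section Coordinates

variable {L : Type u} {n : ℕ}

local notation "𝐍" => n * n + 2 * n

/-- The Plücker coordinate vector `(p_{ij}) ∈ L^{(n+1)²}` of an `L`-valued matrix `p`, indexed by
the homogeneous coordinates of `ℙ^{n²+2n}` through `FanoScheme.plIdx`. [folklore] -/
def vecOfMatrix (p : Fin (n + 1) → Fin (n + 1) → L) : Fin (𝐍 + 1) → L :=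
  fun m => p ((plIdx n).symm m).1 ((plIdx n).symm m).2

variable (n) in
/-- The `L`-valued matrix `(p_{ij})` of a Plücker coordinate vector (inverse to
`FanoScheme.vecOfMatrix`). [folklore] -/
def matrixOfVec (q : Fin (𝐍 + 1) → L) : Fin (n + 1) → Fin (n + 1) → L :=
  fun i j => q (plIdx n (i, j))

/-- `matrixOfVec ∘ vecOfMatrix = id`. [folklore] -/
@[simp]
theorem matrixOfVec_vecOfMatrix (p : Fin (n + 1) → Fin (n + 1) → L) :
    matrixOfVec n (vecOfMatrix p) = p := by
  ext i j
  simp [matrixOfVec, vecOfMatrix]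

/-- `vecOfMatrix ∘ matrixOfVec = id`. [folklore] -/
@[simp]
theorem vecOfMatrix_matrixOfVec (q : Fin (𝐍 + 1) → L) : vecOfMatrix (matrixOfVec n q) = q := by
  ext m
  simp [matrixOfVec, vecOfMatrix]

/-- `vecOfMatrix` is injective. [folklore] -/
theorem vecOfMatrix_injective :
    Function.Injective (vecOfMatrix : (Fin (n + 1) → Fin (n + 1) → L) → Fin (𝐍 + 1) → L) :=
  fun p q h => by rw [← matrixOfVec_vecOfMatrix p, h, matrixOfVec_vecOfMatrix]

variable [Field L]

/-- `vecOfMatrix p = 0 ↔ p = 0`. [folklore] -/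
theorem vecOfMatrix_eq_zero_iff (p : Fin (n + 1) → Fin (n + 1) → L) : vecOfMatrix p = 0 ↔ p = 0 :=
  ⟨fun h => vecOfMatrix_injective (h.trans rfl), fun h => by rw [h]; rfl⟩

/-- `vecOfMatrix` commutes with scalars. [folklore] -/
theorem vecOfMatrix_smul (c : L) (p : Fin (n + 1) → Fin (n + 1) → L) :
    vecOfMatrix (c • p) = c • vecOfMatrix p := rfl

variable {k : Type u} [Field k] [Algebra k L]

/-- The Plücker coordinate `p_{ij}` evaluates to the matrix entry `p i j`. [folklore] -/
@[simp]
theorem aeval_vecOfMatrix_pl (p : Fin (n + 1) → Fin (n + 1) → L) (i j : Fin (n + 1)) :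
    aeval (vecOfMatrix p) (pl n k i j) = p i j := by
  simp [pl, vecOfMatrix]

/-- Value of an alternation relation at an `L`-valued matrix. [folklore] -/
theorem aeval_vecOfMatrix_alternationRel (p : Fin (n + 1) → Fin (n + 1) → L)
    (ij : Fin (n + 1) × Fin (n + 1)) :
    aeval (vecOfMatrix p) (alternationRel n k ij) =
      if ij.1 = ij.2 then p ij.1 ij.1 else p ij.1 ij.2 + p ij.2 ij.1 := by
  unfold alternationRel
  split_ifs <;> simp [vecOfMatrix]

/-- Value of a Plücker relation at an `L`-valued matrix. [folklore] -/
theorem aeval_vecOfMatrix_plueckerRel (p : Fin (n + 1) → Fin (n + 1) → L)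
    (q : Fin (n + 1) × Fin (n + 1) × Fin (n + 1) × Fin (n + 1)) :
    aeval (vecOfMatrix p) (plueckerRel n k q) =
      p q.1 q.2.1 * p q.2.2.1 q.2.2.2 - p q.1 q.2.2.1 * p q.2.1 q.2.2.2 +
        p q.1 q.2.2.2 * p q.2.1 q.2.2.1 := by
  simp only [plueckerRel, map_add, map_sub, map_mul, aeval_vecOfMatrix_pl]

/-- **Value of a containment relation at an `L`-valued matrix `p`**: the `ξ^α`-coefficient of
`g(p ⌟ ξ) ∈ L[ξ]` (evaluation of coefficients commutes with the substitution). [folklore] -/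
theorem aeval_vecOfMatrix_containmentRel (p : Fin (n + 1) → Fin (n + 1) → L)
    (g : MvPolynomial (Fin (n + 1)) k) (α : Fin (n + 1) →₀ ℕ) :
    aeval (vecOfMatrix p) (containmentRel n k g α) = coeff α (aeval (contractionAt p) g) := by
  have key : ((mapAlgHom (aeval (vecOfMatrix p))).comp (aeval (contraction n k)) :
      MvPolynomial (Fin (n + 1)) k →ₐ[k] MvPolynomial (Fin (n + 1)) L) =
      aeval (contractionAt p) := by
    apply MvPolynomial.algHom_ext
    intro i
    simp [contraction, contractionAt, vecOfMatrix, map_sum]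
  unfold containmentRel
  rw [← key, AlgHom.comp_apply, mapAlgHom_apply, coeff_map]
  rfl

/-- **The Fano equations vanish at `u ∧ v` when every `g ∈ S` vanishes identically on the line
`s u + t v`** (alternation and Plücker relations hold for every `u ∧ v`; the containment relations
are the coefficients of `θ_{u,v}(g(su + tv))`). [folklore] -/
theorem aeval_vecOfMatrix_wedge_eq_zero {S : Set (MvPolynomial (Fin (n + 1)) k)}
    {u v : Fin (n + 1) → L} (hg : ∀ g ∈ S, lineRestrict u v g = 0) :
    ∀ f ∈ fanoEquations n k S, aeval (vecOfMatrix (wedge u v)) f = 0 := by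
  rintro f (hf | hf)
  · rcases hf with ⟨ij, rfl⟩ | ⟨q, rfl⟩
    · rw [aeval_vecOfMatrix_alternationRel]
      split_ifs
      · exact wedge_self u v _
      · rw [wedge_swap u v ij.1 ij.2, add_neg_cancel]
    · rw [aeval_vecOfMatrix_plueckerRel]
      exact wedge_pluecker u v _ _ _ _
  · rw [Set.mem_iUnion₂] at hf
    obtain ⟨g, hgS, α, rfl⟩ := hf
    rw [aeval_vecOfMatrix_containmentRel, aeval_contractionAt_wedge, hg g hgS, map_zero, coeff_zero]

/-- For a set `S` of forms of positive degree, **every Fano equation is a form of positive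
degree** (alternation relations: degree `1`; Plücker relations: degree `2`; the containment
relation `coeff_α g(p ⌟ ξ)`: degree `|α|`, and for `α = 0` it is the constant term of `g`, which
vanishes). [folklore] -/
theorem fanoEquations_forms {S : Set (MvPolynomial (Fin (n + 1)) k)}
    (hS : ∀ g ∈ S, ∃ m, 0 < m ∧ g.IsHomogeneous m) :
    ∀ f ∈ fanoEquations n k S, ∃ m, 0 < m ∧ f.IsHomogeneous m := by
  rintro f (hf | hf)
  · rcases hf with ⟨ij, rfl⟩ | ⟨q, rfl⟩
    · exact ⟨1, one_pos, isHomogeneous_alternationRel n k ij⟩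
    · exact ⟨2, two_pos, isHomogeneous_plueckerRel n k q⟩
  · rw [Set.mem_iUnion₂] at hf
    obtain ⟨g, hg, α, rfl⟩ := hf
    by_cases hα : α = 0
    · subst hα
      obtain ⟨m, hm, hgm⟩ := hS g hg
      refine ⟨1, one_pos, ?_⟩
      have h0 : constantCoeff g = 0 := by
        rw [constantCoeff_eq]
        exact hgm.coeff_eq_zero (by rw [map_zero]; exact hm.ne)
      rw [containmentRel_zero, h0, map_zero]
      exact isHomogeneous_zero _ _ _
    · exact ⟨α.degree, Nat.pos_of_ne_zero fun h => hα ((Finsupp.degree_eq_zero_iff α).mp h),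
        isHomogeneous_containmentRel n k g α⟩

end Coordinates

/-! ## Lines on `V₊(S)` over a field -/

section LinesOn

variable {n : ℕ} {k : Type u} [Field k] (S : Set (MvPolynomial (Fin (n + 1)) k))
  (L : Type u) [Field L] [Algebra k L]

/-- **The lines on `V₊(S)` defined over `L`**: the `2`-dimensional subspaces `W ⊆ Lⁿ⁺¹` (lines
`ℙ(W) ⊆ ℙⁿ_L`) on which every `g ∈ S` vanishes IDENTICALLY, i.e. `g(su + tv) = 0` in `L[s, t]`
for all `u, v ∈ W` — the lines contained scheme-theoretically in `V₊(S)_L` (Eisenbud–Harris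
§6.1.1: "the condition `L ⊂ X` is given by the vanishing of the coefficients of `g(su + tv)`").
Over an infinite field this is pointwise vanishing on `W` (`mem_linesOn_iff_of_infinite`); over a
finite field it is stronger. [cite: EisenbudHarris2016, §6.1.1] -/
def linesOn : Set (Submodule L (Fin (n + 1) → L)) :=
  {W | Module.finrank L W = 2 ∧ ∀ g ∈ S, ∀ u ∈ W, ∀ v ∈ W, lineRestrict u v g = 0}

variable {S L}

/-- Membership in `linesOn` (`Iff.rfl`). [folklore] -/
theorem mem_linesOn_iff (W : Submodule L (Fin (n + 1) → L)) :
    W ∈ linesOn S L ↔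
      Module.finrank L W = 2 ∧ ∀ g ∈ S, ∀ u ∈ W, ∀ v ∈ W, lineRestrict u v g = 0 :=
  Iff.rfl

/-- `span(u, v)` (with `u, v` independent) is a line on `V₊(S)` iff every `g ∈ S` vanishes
identically on `su + tv`. [folklore] -/
theorem span_pair_mem_linesOn_iff {u v : Fin (n + 1) → L} (huv : LinearIndependent L ![u, v]) :
    Submodule.span L {u, v} ∈ linesOn S L ↔ ∀ g ∈ S, lineRestrict u v g = 0 := by
  constructor
  · intro h g hg
    exact h.2 g hg u (Submodule.subset_span (Set.mem_insert _ _)) v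
      (Submodule.subset_span (Set.mem_insert_of_mem _ rfl))
  · intro h
    exact ⟨finrank_span_pair huv, fun g hg u' hu' v' hv' =>
      lineRestrict_eq_zero_of_mem_span (h g hg) hu' hv'⟩

/-- A line on `V₊(S)` has a basis `u, v` with `g(su + tv) = 0` for all `g ∈ S`. [folklore] -/
theorem exists_of_mem_linesOn {W : Submodule L (Fin (n + 1) → L)} (hW : W ∈ linesOn S L) :
    ∃ u v : Fin (n + 1) → L, LinearIndependent L ![u, v] ∧ Submodule.span L {u, v} = W ∧
      ∀ g ∈ S, lineRestrict u v g = 0 := by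
  obtain ⟨u, v, huv, rfl⟩ := exists_span_pair_eq_of_finrank_eq_two W hW.1
  exact ⟨u, v, huv, rfl, (span_pair_mem_linesOn_iff huv).mp hW⟩

/-- Every `g ∈ S` vanishes at every vector of a line on `V₊(S)`. [folklore] -/
theorem aeval_eq_zero_of_mem_linesOn {W : Submodule L (Fin (n + 1) → L)} (hW : W ∈ linesOn S L)
    {g : MvPolynomial (Fin (n + 1)) k} (hg : g ∈ S) {w : Fin (n + 1) → L} (hw : w ∈ W) :
    aeval w g = 0 := by
  have h := aeval_eq_zero_of_lineRestrict_eq_zero (hW.2 g hg w hw w hw) 1 0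
  simpa using h

/-- **Over an infinite field, the lines on `V₊(S)` are the `2`-planes `W ⊆ Lⁿ⁺¹` on whose vectors
every `g ∈ S` vanishes** (a polynomial over an infinite field vanishing at all points of `L²` is
zero). [folklore] -/
theorem mem_linesOn_iff_of_infinite [Infinite L] (W : Submodule L (Fin (n + 1) → L)) :
    W ∈ linesOn S L ↔ Module.finrank L W = 2 ∧ ∀ g ∈ S, ∀ w ∈ W, aeval w g = 0 := by
  refine and_congr_right fun _ => forall₂_congr fun g _ => ⟨fun h w hw => ?_, fun h u hu v hv => ?_⟩
  · have h1 := aeval_eq_zero_of_lineRestrict_eq_zero (h w hw w hw) 1 0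
    simpa using h1
  · rw [lineRestrict_eq_zero_iff_of_infinite]
    intro s t
    exact h _ (W.add_mem (W.smul_mem s hu) (W.smul_mem t hv))

/-- Without equations every `2`-plane is a line: `linesOn ∅ L = {W | dim W = 2}`. [folklore] -/
@[simp]
theorem mem_linesOn_empty_iff (W : Submodule L (Fin (n + 1) → L)) :
    W ∈ linesOn (∅ : Set (MvPolynomial (Fin (n + 1)) k)) L ↔ Module.finrank L W = 2 :=
  ⟨fun h => h.1, fun h => ⟨h, fun g hg => absurd hg (Set.notMem_empty g)⟩⟩

end LinesOn

/-! ## `L`-points of the Fano scheme -/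

section Points

variable {n : ℕ} {k : Type u} [Field k] {L : Type u} [Field L] [Algebra k L]
  {S : Set (MvPolynomial (Fin (n + 1)) k)}

/-- **The `L`-point `[u ∧ v]` of the Fano scheme `F₁(V₊(S))`**: for linearly independent
`u, v ∈ Lⁿ⁺¹` such that every `g ∈ S` vanishes identically on the line `ℙ(span(u, v))`
(`g(su + tv) = 0` in `L[s, t]`), the `L`-point of `F₁(V₊(S)) ⊆ ℙ^{n²+2n}` with Plücker coordinates
`p_{ij} = uᵢvⱼ - uⱼvᵢ` (Eisenbud–Harris, *3264 and all that*, §3.2.1 and §6.1.1).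
[cite: EisenbudHarris2016, §6.1.1] -/
def linePoint (hS : ∀ g ∈ S, ∃ m, 0 < m ∧ g.IsHomogeneous m) (u v : Fin (n + 1) → L)
    (huv : LinearIndependent L ![u, v]) (hg : ∀ g ∈ S, lineRestrict u v g = 0) :
    AlgPoints (fanoSchemeOfLines n k S) L :=
  ProjectiveSpace.subschemePointOfVec (fanoEquations_forms hS) (vecOfMatrix (wedge u v))
    ((vecOfMatrix_eq_zero_iff _).not.mpr ((wedge_ne_zero_iff u v).mpr huv))
    (aeval_vecOfMatrix_wedge_eq_zero hg)

/-- **The Plücker embedding sends `[u ∧ v]` to the point of `ℙ^{n²+2n}` with homogeneous coordinates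
`(uᵢvⱼ - uⱼvᵢ)_{ij}`.** [folklore] -/
@[simp]
theorem map_linePoint (hS : ∀ g ∈ S, ∃ m, 0 < m ∧ g.IsHomogeneous m) (u v : Fin (n + 1) → L)
    (huv : LinearIndependent L ![u, v]) (hg : ∀ g ∈ S, lineRestrict u v g = 0) :
    AlgPoints.map (fanoSchemeOfLinesι n k S) (linePoint hS u v huv hg) =
      ProjectiveSpace.pointOfVec k (vecOfMatrix (wedge u v))
        ((vecOfMatrix_eq_zero_iff _).not.mpr ((wedge_ne_zero_iff u v).mpr huv)) :=
  ProjectiveSpace.map_subschemePointOfVec _ _ _ _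

/-- **Every `L`-point of `F₁(V₊(S))` is of the form `[u ∧ v]`** for linearly independent `u, v`
spanning a line on which `S` vanishes identically: an `L`-point has Plücker coordinates `p ≠ 0`
satisfying the Plücker relations, hence `p = p_{a•} ∧ p_{b•}/p_{ab}` on the chart `p_{ab} ≠ 0`
(Eisenbud–Harris §3.2.2), and the containment relations say `g(p ⌟ ξ) = θ_{u,v}(g(su + tv)) = 0`
with `θ_{u,v}` injective. [cite: EisenbudHarris2016, §3.2.2 and §6.1.1] -/
theorem exists_eq_linePoint (hS : ∀ g ∈ S, ∃ m, 0 < m ∧ g.IsHomogeneous m)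
    (P : AlgPoints (fanoSchemeOfLines n k S) L) :
    ∃ (u v : Fin (n + 1) → L) (huv : LinearIndependent L ![u, v])
      (hg : ∀ g ∈ S, lineRestrict u v g = 0), P = linePoint hS u v huv hg := by
  obtain ⟨q, hq0, hqS, rfl⟩ :=
    ProjectiveSpace.exists_eq_subschemePointOfVec (fanoEquations_forms hS) P
  obtain ⟨p, rfl⟩ : ∃ p, q = vecOfMatrix p := ⟨matrixOfVec n q, (vecOfMatrix_matrixOfVec q).symm⟩
  have hp0 : p ≠ 0 := fun h => hq0 ((vecOfMatrix_eq_zero_iff p).mpr h)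
  obtain ⟨a, b, hab⟩ := exists_apply_ne_zero_of_ne_zero hp0
  have hpl : ∀ i j, p a b * p i j - p a i * p b j + p a j * p b i = 0 := fun i j => by
    have h := hqS _ (grassmannEquations_subset_fanoEquations n k S (Or.inr ⟨(a, b, i, j), rfl⟩))
    rwa [aeval_vecOfMatrix_plueckerRel] at h
  have hpw : p = wedge (p a) ((p a b)⁻¹ • p b) := eq_wedge_of_pluecker hpl hab
  have huv : LinearIndependent L ![p a, (p a b)⁻¹ • p b] :=
    (wedge_ne_zero_iff _ _).mp (hpw ▸ hp0)
  have hg : ∀ g ∈ S, lineRestrict (p a) ((p a b)⁻¹ • p b) g = 0 := fun g hgS => by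
    rw [← aeval_contractionAt_wedge_eq_zero_iff huv, ← hpw]
    ext α
    have h := hqS _ (containmentRel_mem_fanoEquations n k hgS α)
    rwa [aeval_vecOfMatrix_containmentRel, ← coeff_zero α] at h
  refine ⟨p a, (p a b)⁻¹ • p b, huv, hg, ?_⟩
  unfold linePoint
  rw [ProjectiveSpace.subschemePointOfVec_eq_iff]
  exact ⟨1, one_ne_zero, by rw [one_smul, ← hpw]⟩

/-- **`[u ∧ v] = [u' ∧ v']` iff `span(u, v) = span(u', v')`**: an `L`-point of the Fano scheme
is exactly a line `ℙ(W) ⊆ ℙⁿ_L` (homogeneous Plücker coordinates are unique up to `Lˣ`, and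
`u' ∧ v' = c • u ∧ v` iff the spans agree). [cite: EisenbudHarris2016, §3.2.1] -/
theorem linePoint_eq_linePoint_iff (hS : ∀ g ∈ S, ∃ m, 0 < m ∧ g.IsHomogeneous m)
    {u v u' v' : Fin (n + 1) → L} (huv : LinearIndependent L ![u, v])
    (hg : ∀ g ∈ S, lineRestrict u v g = 0) (huv' : LinearIndependent L ![u', v'])
    (hg' : ∀ g ∈ S, lineRestrict u' v' g = 0) :
    linePoint hS u v huv hg = linePoint hS u' v' huv' hg' ↔
      Submodule.span L {u, v} = Submodule.span L {u', v'} := by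
  unfold linePoint
  rw [ProjectiveSpace.subschemePointOfVec_eq_iff]
  constructor
  · rintro ⟨c, hc, h⟩
    rw [← vecOfMatrix_smul, vecOfMatrix_injective.eq_iff] at h
    exact (span_pair_eq_of_wedge_eq_smul huv huv' hc h).symm
  · intro h
    obtain ⟨c, hc, hw⟩ := exists_wedge_eq_smul_wedge huv' h.symm.le
    exact ⟨c, hc, by rw [← vecOfMatrix_smul, hw]⟩

/-- **Functoriality**: for `S ⊆ T` the closed immersion `F₁(V₊(T)) ↪ F₁(V₊(S))` sends `[u ∧ v]`
to `[u ∧ v]`. [folklore] -/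
theorem map_fanoSchemeOfLinesInclusion_linePoint {T : Set (MvPolynomial (Fin (n + 1)) k)}
    (h : S ⊆ T) (hS : ∀ g ∈ S, ∃ m, 0 < m ∧ g.IsHomogeneous m)
    (hT : ∀ g ∈ T, ∃ m, 0 < m ∧ g.IsHomogeneous m) (u v : Fin (n + 1) → L)
    (huv : LinearIndependent L ![u, v]) (hgT : ∀ g ∈ T, lineRestrict u v g = 0) :
    AlgPoints.map (fanoSchemeOfLinesInclusion h) (linePoint hT u v huv hgT) =
      linePoint hS u v huv (fun g hg => hgT g (h hg)) := by
  apply AlgPoints.map_injective_of_mono (fanoSchemeOfLinesι n k S)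
  rw [← AlgPoints.map_comp_apply, fanoSchemeOfLinesInclusion_ι, map_linePoint, map_linePoint]

/-! ### The Galois action -/

/-- Linear independence is preserved by `k`-automorphisms of `L` acting coordinatewise. [folklore] -/
theorem linearIndependent_algEquiv_comp (σ : L ≃ₐ[k] L) {u v : Fin (n + 1) → L}
    (huv : LinearIndependent L ![u, v]) :
    LinearIndependent L ![fun j => σ (u j), fun j => σ (v j)] := by
  rw [← wedge_ne_zero_iff] at huv ⊢
  obtain ⟨a, b, hab⟩ := exists_apply_ne_zero_of_ne_zero huv
  have h : wedge (fun j => σ (u j)) (fun j => σ (v j)) a b = σ (wedge u v a b) := by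
    simp [wedge]
  refine Function.ne_iff.mpr ⟨a, Function.ne_iff.mpr ⟨b, ?_⟩⟩
  rw [h]
  exact EmbeddingLike.map_ne_zero_iff.mpr hab

/-- **Galois acts on `[u ∧ v]` coordinatewise**: `σ • [u ∧ v] = [σ(u) ∧ σ(v)]` for `σ ∈ Aut(L/k)`
(the action `σ • P = Spec σ ≫ P` of `Motives/AlgPoints`; Hartshorne II Ex. 4.7). In particular the
line of `σ • P` is `σ` applied to the line of `P`. [folklore] -/
theorem smul_linePoint (σ : L ≃ₐ[k] L) (hS : ∀ g ∈ S, ∃ m, 0 < m ∧ g.IsHomogeneous m)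
    (u v : Fin (n + 1) → L) (huv : LinearIndependent L ![u, v])
    (hg : ∀ g ∈ S, lineRestrict u v g = 0) :
    σ • linePoint hS u v huv hg =
      linePoint hS (fun j => σ (u j)) (fun j => σ (v j)) (linearIndependent_algEquiv_comp σ huv)
        (fun g hgS => (lineRestrict_algEquiv_eq_zero_iff σ u v g).mpr (hg g hgS)) := by
  apply AlgPoints.map_injective_of_mono (fanoSchemeOfLinesι n k S)
  rw [AlgPoints.map_smul, map_linePoint, map_linePoint, ProjectiveSpace.smul_pointOfVec]
  congr 1
  ext m
  simp [vecOfMatrix, wedge]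

/-! ### The line of an `L`-point and the bijection with lines on `V₊(S)` -/

/-- **The line `W ⊆ Lⁿ⁺¹` of an `L`-point of `F₁(V₊(S))`**: the span of `u, v` for any
presentation `P = [u ∧ v]` (`exists_eq_linePoint`; independent of the presentation by
`linePoint_eq_linePoint_iff`). [folklore] -/
def lineOf (hS : ∀ g ∈ S, ∃ m, 0 < m ∧ g.IsHomogeneous m)
    (P : AlgPoints (fanoSchemeOfLines n k S) L) : Submodule L (Fin (n + 1) → L) :=
  Submodule.span L
    {(exists_eq_linePoint hS P).choose, (exists_eq_linePoint hS P).choose_spec.choose}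

/-- The defining property of `lineOf`. [folklore] -/
theorem lineOf_spec (hS : ∀ g ∈ S, ∃ m, 0 < m ∧ g.IsHomogeneous m)
    (P : AlgPoints (fanoSchemeOfLines n k S) L) :
    ∃ (u v : Fin (n + 1) → L) (huv : LinearIndependent L ![u, v])
      (hg : ∀ g ∈ S, lineRestrict u v g = 0),
      P = linePoint hS u v huv hg ∧ lineOf hS P = Submodule.span L {u, v} :=
  ⟨_, _, (exists_eq_linePoint hS P).choose_spec.choose_spec.choose,
    (exists_eq_linePoint hS P).choose_spec.choose_spec.choose_spec.choose,
    (exists_eq_linePoint hS P).choose_spec.choose_spec.choose_spec.choose_spec, rfl⟩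

/-- **`lineOf [u ∧ v] = span(u, v)`.** [folklore] -/
@[simp]
theorem lineOf_linePoint (hS : ∀ g ∈ S, ∃ m, 0 < m ∧ g.IsHomogeneous m) (u v : Fin (n + 1) → L)
    (huv : LinearIndependent L ![u, v]) (hg : ∀ g ∈ S, lineRestrict u v g = 0) :
    lineOf hS (linePoint hS u v huv hg) = Submodule.span L {u, v} := by
  obtain ⟨u', v', huv', hg', h1, h2⟩ := lineOf_spec hS (linePoint hS u v huv hg)
  rw [h2]
  exact ((linePoint_eq_linePoint_iff hS huv hg huv' hg').mp h1).symm

/-- `lineOf` is compatible with the inclusions `F₁(V₊(T)) ↪ F₁(V₊(S))`, `S ⊆ T`. [folklore] -/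
theorem lineOf_map_fanoSchemeOfLinesInclusion {T : Set (MvPolynomial (Fin (n + 1)) k)}
    (h : S ⊆ T) (hS : ∀ g ∈ S, ∃ m, 0 < m ∧ g.IsHomogeneous m)
    (hT : ∀ g ∈ T, ∃ m, 0 < m ∧ g.IsHomogeneous m) (P : AlgPoints (fanoSchemeOfLines n k T) L) :
    lineOf hS (AlgPoints.map (fanoSchemeOfLinesInclusion h) P) = lineOf hT P := by
  obtain ⟨u, v, huv, hg, rfl⟩ := exists_eq_linePoint hT P
  rw [map_fanoSchemeOfLinesInclusion_linePoint h hS hT, lineOf_linePoint, lineOf_linePoint]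

/-- **The line of `σ • [u ∧ v]` is `span(σ(u), σ(v))`.** [folklore] -/
theorem lineOf_smul_linePoint (σ : L ≃ₐ[k] L) (hS : ∀ g ∈ S, ∃ m, 0 < m ∧ g.IsHomogeneous m)
    (u v : Fin (n + 1) → L) (huv : LinearIndependent L ![u, v])
    (hg : ∀ g ∈ S, lineRestrict u v g = 0) :
    lineOf hS (σ • linePoint hS u v huv hg) =
      Submodule.span L {fun j => σ (u j), fun j => σ (v j)} := by
  rw [smul_linePoint, lineOf_linePoint]

/-- The line of an `L`-point of `F₁(V₊(S))` is a line on `V₊(S)`. [folklore] -/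
theorem lineOf_mem_linesOn (hS : ∀ g ∈ S, ∃ m, 0 < m ∧ g.IsHomogeneous m)
    (P : AlgPoints (fanoSchemeOfLines n k S) L) : lineOf hS P ∈ linesOn S L := by
  obtain ⟨u, v, huv, hg, -, h2⟩ := lineOf_spec hS P
  rw [h2]
  exact (span_pair_mem_linesOn_iff huv).mpr hg

/-- **`lineOf` is injective**: an `L`-point of the Fano scheme is determined by its line.
[folklore] -/
theorem lineOf_injective (hS : ∀ g ∈ S, ∃ m, 0 < m ∧ g.IsHomogeneous m) :
    Function.Injective (lineOf (L := L) hS) := by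
  intro P Q h
  obtain ⟨u, v, huv, hg, rfl⟩ := exists_eq_linePoint hS P
  obtain ⟨u', v', huv', hg', rfl⟩ := exists_eq_linePoint hS Q
  rw [lineOf_linePoint, lineOf_linePoint] at h
  exact (linePoint_eq_linePoint_iff hS huv hg huv' hg').mpr h

/-- **`lineOf` is surjective onto the lines on `V₊(S)`.** [folklore] -/
theorem exists_lineOf_eq (hS : ∀ g ∈ S, ∃ m, 0 < m ∧ g.IsHomogeneous m)
    {W : Submodule L (Fin (n + 1) → L)} (hW : W ∈ linesOn S L) :
    ∃ P : AlgPoints (fanoSchemeOfLines n k S) L, lineOf hS P = W := by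
  obtain ⟨u, v, huv, rfl, hg⟩ := exists_of_mem_linesOn hW
  exact ⟨linePoint hS u v huv hg, lineOf_linePoint hS u v huv hg⟩

/-- **The `L`-points of the Fano scheme of lines are the lines on `V₊(S)` defined over `L`**:
`F₁(V₊(S))(L) ≃ {W ⊆ Lⁿ⁺¹ : dim W = 2, g|_W ≡ 0 ∀ g ∈ S}`, `P ↦ lineOf P`, `[u ∧ v] ↤ span(u, v)`,
for `S` a set of forms of positive degree and any field extension `L ⊇ k` (Eisenbud–Harris,
*3264 and all that*, §6.1.1 and Prop. 6.6: `F_k(X)` parametrises the `k`-planes contained in `X`;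
here for field-valued points of the scheme `fanoSchemeOfLines` of `Motives/FanoSchemeOfLines`).
[cite: EisenbudHarris2016, §6.1.1 and Prop. 6.6] -/
def algPointsEquivLinesOn (hS : ∀ g ∈ S, ∃ m, 0 < m ∧ g.IsHomogeneous m) :
    AlgPoints (fanoSchemeOfLines n k S) L ≃ linesOn S L :=
  Equiv.ofBijective (fun P => ⟨lineOf hS P, lineOf_mem_linesOn hS P⟩)
    ⟨fun _ _ h => lineOf_injective hS (congrArg Subtype.val h), fun W => by
      obtain ⟨P, hP⟩ := exists_lineOf_eq hS W.2
      exact ⟨P, Subtype.ext hP⟩⟩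

/-- `algPointsEquivLinesOn P = lineOf P` (`rfl`). [folklore] -/
@[simp]
theorem coe_algPointsEquivLinesOn (hS : ∀ g ∈ S, ∃ m, 0 < m ∧ g.IsHomogeneous m)
    (P : AlgPoints (fanoSchemeOfLines n k S) L) :
    ((algPointsEquivLinesOn hS P : linesOn S L) : Submodule L (Fin (n + 1) → L)) = lineOf hS P :=
  rfl

/-- **`algPointsEquivLinesOn [u ∧ v] = span(u, v)`.** [folklore] -/
theorem coe_algPointsEquivLinesOn_linePoint (hS : ∀ g ∈ S, ∃ m, 0 < m ∧ g.IsHomogeneous m)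
    (u v : Fin (n + 1) → L) (huv : LinearIndependent L ![u, v])
    (hg : ∀ g ∈ S, lineRestrict u v g = 0) :
    ((algPointsEquivLinesOn hS (linePoint hS u v huv hg) : linesOn S L) :
      Submodule L (Fin (n + 1) → L)) = Submodule.span L {u, v} :=
  lineOf_linePoint hS u v huv hg

/-- **The inverse bijection sends the line `span(u, v)` to `[u ∧ v]`.** [folklore] -/
theorem algPointsEquivLinesOn_symm_apply (hS : ∀ g ∈ S, ∃ m, 0 < m ∧ g.IsHomogeneous m)
    {u v : Fin (n + 1) → L} (huv : LinearIndependent L ![u, v])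
    (hg : ∀ g ∈ S, lineRestrict u v g = 0) (hW : Submodule.span L {u, v} ∈ linesOn S L) :
    (algPointsEquivLinesOn hS).symm ⟨Submodule.span L {u, v}, hW⟩ = linePoint hS u v huv hg := by
  apply (algPointsEquivLinesOn hS).injective
  rw [Equiv.apply_symm_apply]
  exact Subtype.ext (lineOf_linePoint hS u v huv hg).symm

/-- **Over an infinite field `L ⊇ k`: `F₁(V₊(S))(L) ≃ {W ⊆ Lⁿ⁺¹ : dim W = 2, g(w) = 0 ∀ g ∈ S,
w ∈ W}`** — the `L`-points of the Fano scheme are the `2`-planes on whose vectors every equation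
vanishes (`algPointsEquivLinesOn` and `mem_linesOn_iff_of_infinite`). [folklore] -/
def algPointsEquivLinesOnOfInfinite [Infinite L] (hS : ∀ g ∈ S, ∃ m, 0 < m ∧ g.IsHomogeneous m) :
    AlgPoints (fanoSchemeOfLines n k S) L ≃
      {W : Submodule L (Fin (n + 1) → L) //
        Module.finrank L W = 2 ∧ ∀ g ∈ S, ∀ w ∈ W, aeval w g = 0} :=
  (algPointsEquivLinesOn hS).trans (Equiv.subtypeEquivRight fun W => mem_linesOn_iff_of_infinite W)

/-- `algPointsEquivLinesOnOfInfinite P = lineOf P` (`rfl`). [folklore] -/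
@[simp]
theorem coe_algPointsEquivLinesOnOfInfinite [Infinite L]
    (hS : ∀ g ∈ S, ∃ m, 0 < m ∧ g.IsHomogeneous m) (P : AlgPoints (fanoSchemeOfLines n k S) L) :
    ((algPointsEquivLinesOnOfInfinite hS P : {W : Submodule L (Fin (n + 1) → L) //
        Module.finrank L W = 2 ∧ ∀ g ∈ S, ∀ w ∈ W, aeval w g = 0}) :
      Submodule L (Fin (n + 1) → L)) = lineOf hS P :=
  rfl

/-- **The `L`-points of the Grassmannian of lines `G(1, ℙⁿ_k)` are the `2`-planes `W ⊆ Lⁿ⁺¹`**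
(the lines `ℙ(W) ⊆ ℙⁿ_L`; Eisenbud–Harris §3.2.1–§3.2.2). [cite: EisenbudHarris2016, §3.2.2] -/
def grassmannianPointsEquiv :
    AlgPoints (grassmannianOfLines n k) L ≃
      {W : Submodule L (Fin (n + 1) → L) // Module.finrank L W = 2} :=
  (algPointsEquivLinesOn (S := (∅ : Set (MvPolynomial (Fin (n + 1)) k)))
      (fun g h => absurd h (Set.notMem_empty g))).trans
    (Equiv.subtypeEquivRight fun W => mem_linesOn_empty_iff W)

end Points

end FanoScheme

end Literature.AlgebraicGeometry.Motives
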